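import Summits.BirchSwinnertonDyer.BirchSwinnertonDyer.Theorems.GoldfeldAllTwistsTwoConverseTwinBirchHalvability
import Summits.BirchSwinnertonDyer.BirchSwinnertonDyer.Theorems.GoldfeldAllTwistsTwoConverseTwinAdditiveTwoPrimeTwistSelmer
import Summits.BirchSwinnertonDyer.BirchSwinnertonDyer.Theorems.GoldfeldAllTwistsTwoConverseTwinAdditiveInertTwistDescent
import HarnessLib

set_option linter.dupNamespace false -- `…BirchSwinnertonDyer.BirchSwinnertonDyer…` is the cell's namespace (D-0017)
set_option autoImplicit false

/-!
# LINE B49 — THEOREM B′ (family F2, `d_K = −8q`), local input (B1c′): `#X₀(49)(K)_tors = 2` for `K = ℚ(√−2q)`, and the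
# HALVABILITY VALUE `k = 1` on the whole family `49a1^{(−2q)}`, `q ≡ 1 (mod 4)` prime, `(q/7) = −1`

Cell `bsd-goldfeld`, seat `bsd-goldfeld-s1p-c301` (prover, gen 9); planner ruling g25 (cii) (THEOREM B′ = clause (ii) of
`X049BirchLemmaEvenDiscrEight` on F2), scope memo `HOME/GENUS-THEOREM-B-PRIME.md` factors F4 (`t_K = #cm7(K)_tors`) and F10
(«halvability `k` DECIDED by descent uniformly in `q`»). Support for item `stmt-BirchSwinnertonDyer-19140` (twin″); Theses-free;
theorems only. HONEST FRAMING: a torsion computation over an infinite family of quadratic fields and a statement about the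
Mordell–Weil group of the twists `49a1^{(−2q)}`; nothing about `L`-values or BSD is proved; the rank-one hypothesis is a
binder (on the family it follows from Gross–Zagier–Kolyvagin). The F1 twins of this file are `…TwinBirchTorsionK` (B1c-α)
and `…TwinBirchHalvability` (B1c-β), whose `q`-free lemmas (§§2–3 there: odd torsion of `M₀(K)`, `#M₀^{(d)}(ℚ)_tors = 2`,
the transport lemmas `congrEquiv_incl` / `pointEquivBaseChange_incl`) are reused, not restated.

WHAT IS PROVED (`q` prime with `(q/7) = −1`, `K` imaginary quadratic with `d_K = −8q`). §1 `−7, 7, 2, 14 ∉ K²`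
(`not_isSquare_negEightField`: a rational square in `K` is a rational square or `−8q` times one; `−7·(−8q) = 14q·2²`).
§2 `M₀(K)_tors = {O, T}` on `M₀ = ⟨0, 21, 0, 112, 0⟩ = cm7NFChange • X₀(49)`, hence
**`torsionOrder_cm7_baseChange_eq_two_negEight`** — factor `t_K` of `𝔮₄₉` (kit j273920: PARI `elltors` = `[2]`, 20 primes).
§3 on `E_{−2q} = ⟨0, −42q, 0, 448q², 0⟩`, `q ≡ 1 (mod 4)`: in rank one `α(E(ℚ)) = {[1],[2],[7],[14]}` (`[S(−42q, 448q²)] ⊆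
{1,2,7,14}`, `#α′ ≤ #S′ ≤ 2` by seat c301 gen 2's `mem_of_mem_twoIsogenySelmerGroup{,'}_twoPrimeTwist`, `#α·#α′ = 8`), so
SOME rational point has `α(P) = [2]`. §4 such a point is not in `2E(K) + E(K)_tors` (`2`, `14`, `b ~ 7`, `a² − 4b ~ −7 ∉ K²`,
tree `some_ne_two_zsmul_add_of_not_isSquare`); transport to ANY model `W`, `C • W = X₀(49)^{(−2q)}`, of rank one:
**`not_forall_halvable_twoPrimeTwist`** — the `k = 2` branch of `X049BirchLemmaEvenDiscrEight` is EMPTY on F2 (kit j259049: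
`k = 1` on all 218 odd primes `q < 3000`). References: [SilvermanTate2015] §3.5–3.6; [SilvermanAEC2009] VII.3, X.4.9,
Exercise 10.16; [BurungaleCastellaSkinnerTian2022] Rem. D (p. 327).
-/

noncomputable section

open scoped Classical

open WeierstrassCurve Literature.NumberTheory.EllipticCurves Literature.NumberTheory.EllipticCurves.ModularForms
  WeierstrassCurve.QuadraticDescent
open WeierstrassCurve.Affine (sqClass sqClass_mul sqClass_eq_one_iff)

namespace Summit.BirchSwinnertonDyer.BirchSwinnertonDyer.Theorems.GoldfeldGoodTwists

-- DECIDABILITY: as in F1's `…TwinBirchHalvability`, NO local classical instance attribute (the `ℚ`-descent of §3 uses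
-- `decide` / `Finset.card_le_two` on literal finsets of integers); the `K`-points of §§2, 4 are classical either way.

/-! ## §1 The four non-squares of `K = ℚ(√−2q)` -/

section SquaresNegEight

variable {K : Type} [Field K] [NumberField K]

/-- **`−7, 7, 2, 14` are not squares in `K`** for `K` imaginary quadratic with `d_K = −8q`, `q` prime, `(q/7) = −1`
(so `q ≠ 2, 7`): a rational square in `K` is a square in `ℚ` or `−8q` times one; `−7·(−8q) = 14q·2²`.
[cite: SilvermanTate2015, §3.5] -/
theorem not_isSquare_negEightField (hK : IsImaginaryQuadratic K) {q : ℕ} (hq : q.Prime)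
    (hq7 : jacobiSym q 7 = -1) (hdK : NumberField.discr K = -(8 * (q : ℤ))) :
    ¬ IsSquare (-7 : K) ∧ ¬ IsSquare (7 : K) ∧ ¬ IsSquare (2 : K) ∧ ¬ IsSquare (14 : K) := by
  obtain ⟨hq2, hq7'⟩ := ne_two_and_ne_seven_of_jacobiSym hq7
  obtain ⟨⟨-, -⟩, ⟨n7, -⟩, ⟨-, -⟩, ⟨n2, -⟩, ⟨-, -⟩, ⟨n14, -⟩⟩ := not_isSquare_genusConstants hq hq2 hq7'
  have hq0 : (0 : ℚ) < q := by exact_mod_cast hq.pos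
  have n14q : ¬ IsSquare ((14 * q : ℕ) : ℚ) := by
    rw [Rat.isSquare_natCast_iff]; exact not_isSquare_fourteen_mul_prime hq
  have hdQ : ((NumberField.discr K : ℤ) : ℚ) = -(8 * (q : ℚ)) := by rw [hdK]; push_cast; ring
  have red : ∀ c : ℚ, IsSquare ((c : K)) → IsSquare c ∨ IsSquare (c * -(8 * (q : ℚ))) := by
    intro c hc
    rw [← hdQ]
    refine isSquare_or_of_isSquare_algebraMap_rat hK ?_
    rwa [eq_ratCast]
  refine ⟨fun h => ?_, fun h => ?_, fun h => ?_, fun h => ?_⟩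
  · rcases red (-7) (by push_cast; exact h) with h' | h'
    · exact not_isSquare_of_neg (by norm_num) h'
    · refine n14q ?_
      push_cast; exact isSquare_of_isSquare_four_mul (by convert h' using 1; ring)
  · rcases red 7 (by push_cast; exact h) with h' | h'
    · exact n7 h'
    · exact not_isSquare_of_neg (by nlinarith) h'
  · rcases red 2 (by push_cast; exact h) with h' | h'
    · exact n2 h'
    · exact not_isSquare_of_neg (by nlinarith) h'
  · rcases red 14 (by push_cast; exact h) with h' | h'
    · exact n14 h'
    · exact not_isSquare_of_neg (by nlinarith) h'

end SquaresNegEight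

/-! ## §2 `M₀(K)_tors = {O, T}` and `#X₀(49)(K)_tors = 2` for `d_K = −8q` -/

section TorsionNegEight

variable {K : Type} [Field K] [NumberField K]

/-- **`M₀(K)_tors = {O, T}`** (`M₀ = ⟨0,21,0,112,0⟩`, `K` imaginary quadratic with `d_K = −8q`): a torsion point `t` has an
odd multiple in `{O, T}` (`−7 = a² − 4b` and `7 ~ b = 112` are not squares in `K`), so `2 • t` is killed by an odd integer,
hence `O` (F1's `eq_zero_of_odd_nsmul_eq_zero_M0`, generic in `K`), and `t ∈ M₀(K)[2] = {O, T}`.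
[cite: SilvermanTate2015, §3.5] [cite: SilvermanAEC2009, Exercise 10.16] -/
theorem isOfFinAddOrder_iff_M0_K_negEight (hK : IsImaginaryQuadratic K) {q : ℕ} (hq : q.Prime)
    (hq7 : jacobiSym q 7 = -1) (hdK : NumberField.discr K = -(8 * (q : ℤ)))
    (t : (⟨0, 21, 0, 112, 0⟩ : WeierstrassCurve K).toAffine.Point) :
    IsOfFinAddOrder t ↔ t = 0 ∨ t = (haveI := isElliptic_M0_K (K := K);
      (⟨0, 21, 0, 112, 0⟩ : WeierstrassCurve K).twoTorsionPoint) := by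
  haveI := isElliptic_M0_K (K := K)
  obtain ⟨h7, h7', -, -⟩ := not_isSquare_negEightField hK hq hq7 hdK
  have hD : ¬ IsSquare ((⟨0, 21, 0, 112, 0⟩ : WeierstrassCurve K).a₂ ^ 2 -
      4 * (⟨0, 21, 0, 112, 0⟩ : WeierstrassCurve K).a₄) := by
    rw [show ((⟨0, 21, 0, 112, 0⟩ : WeierstrassCurve K).a₂ ^ 2 -
      4 * (⟨0, 21, 0, 112, 0⟩ : WeierstrassCurve K).a₄) = -7 by norm_num]
    exact h7
  have hb : ¬ IsSquare (⟨0, 21, 0, 112, 0⟩ : WeierstrassCurve K).a₄ := by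
    rw [show (⟨0, 21, 0, 112, 0⟩ : WeierstrassCurve K).a₄ = 112 by rfl]
    rintro ⟨r, hr⟩
    exact h7' (isSquare_of_sq_mul (k := 4) (by norm_num) (by linear_combination hr.symm))
  constructor
  · intro ht
    obtain ⟨m, hm, h⟩ := (⟨0, 21, 0, 112, 0⟩ : WeierstrassCurve K).exists_odd_nsmul_mem_pair hD hb ht
    have h2m : m • ((2 : ℕ) • t) = 0 := by
      rw [← mul_nsmul', mul_comm, mul_nsmul']
      rcases h with h | h
      · rw [h, nsmul_zero]
      · rw [h, two_nsmul, twoTorsionPoint_add_twoTorsionPoint]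
    have h2 : (2 : ℕ) • t = 0 := eq_zero_of_odd_nsmul_eq_zero_M0 hK _ hm h2m
    exact (⟨0, 21, 0, 112, 0⟩ : WeierstrassCurve K).eq_zero_or_eq_twoTorsionPoint_of_two_nsmul_eq_zero hD t h2
  · rintro (rfl | rfl)
    · exact IsOfFinAddOrder.zero
    · exact isOfFinAddOrder_iff_nsmul_eq_zero.mpr ⟨2, two_pos, by rw [two_nsmul, twoTorsionPoint_add_twoTorsionPoint]⟩

/-- **`#M₀(K)_tors = 2`** for `d_K = −8q`. [cite: SilvermanTate2015, §3.5] -/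
theorem torsionOrder_M0_K_negEight (hK : IsImaginaryQuadratic K) {q : ℕ} (hq : q.Prime)
    (hq7 : jacobiSym q 7 = -1) (hdK : NumberField.discr K = -(8 * (q : ℤ))) :
    (⟨0, 21, 0, 112, 0⟩ : WeierstrassCurve K).torsionOrder = 2 := by
  haveI := isElliptic_M0_K (K := K)
  unfold WeierstrassCurve.torsionOrder
  set T := (⟨0, 21, 0, 112, 0⟩ : WeierstrassCurve K).twoTorsionPoint with hT
  have hTtors : T ∈ AddCommGroup.torsion (⟨0, 21, 0, 112, 0⟩ : WeierstrassCurve K).toAffine.Point :=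
    (AddCommGroup.mem_torsion _).mpr ((isOfFinAddOrder_iff_M0_K_negEight hK hq hq7 hdK T).mpr (Or.inr rfl))
  have hT0 : T ≠ 0 := twoTorsionPoint_ne_zero _
  rw [Nat.card_eq_two_iff' (⟨T, hTtors⟩ : AddCommGroup.torsion (⟨0, 21, 0, 112, 0⟩ : WeierstrassCurve K).toAffine.Point)]
  refine ⟨0, fun h0 => hT0 (congrArg Subtype.val h0).symm, fun y hy => ?_⟩
  have hyfin : IsOfFinAddOrder (y : (⟨0, 21, 0, 112, 0⟩ : WeierstrassCurve K).toAffine.Point) := y.2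
  rcases (isOfFinAddOrder_iff_M0_K_negEight hK hq hq7 hdK _).mp hyfin with h | h
  · exact Subtype.ext h
  · exact absurd (Subtype.ext h) hy

/-- **`#X₀(49)(K)_tors = 2` for every imaginary quadratic `K` with `d_K = −8q`, `q` prime, `(q/7) = −1`** (factor `t_K` of
`𝔮₄₉` on the family F2; transport of `torsionOrder_M0_K_negEight` along `cm7NFChange K • (cm7 ⊗ K) = M₀`).
[cite: SilvermanTate2015, §3.5] [cite: SilvermanAEC2009, Exercise 10.16] [cite: BurungaleCastellaSkinnerTian2022, Rem. D (p. 327)] -/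
theorem torsionOrder_cm7_baseChange_eq_two_negEight (hK : IsImaginaryQuadratic K) {q : ℕ} (hq : q.Prime)
    (hq7 : jacobiSym q 7 = -1) (hdK : NumberField.discr K = -(8 * (q : ℤ))) :
    (cm7.baseChange K).torsionOrder = 2 := by
  have h := torsionOrder_variableChange_holds (cm7.baseChange K) (cm7NFChange K)
  unfold torsionOrder_variableChange at h
  rw [cm7NFChange_smul] at h
  rw [← h]
  exact torsionOrder_M0_K_negEight hK hq hq7 hdK

end TorsionNegEight

/-! ## §3 In rank one the descent image of `E_{−2q} = ⟨0, −42q, 0, 448q², 0⟩` is `{1, 2, 7, 14}` -/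

section DescentNegEight

variable {l : ℕ}

/-- **`#α′(E′(ℚ)) ≤ 2`** for the `2`-isogenous curve `E′ = ⟨0, 84q, 0, −28q², 0⟩` of `E_{−2q}`: `2^{dim S′} = #α′ · #Ш-part`
(tree `two_pow_twoIsogenySelmerRank'_eq_natCard_mul`) and `#S′(84q, −28q²) ≤ 2` (seat c301 gen 2,
`mem_of_mem_twoIsogenySelmerGroup'_twoPrimeTwist`). [cite: SilvermanAEC2009, Thm. X.4.2(a) and Prop. X.4.9] -/
theorem natCard_range_xSqClass_codomain_le_two_twoPrimeTwist [Fact l.Prime] (hl4 : l % 4 = 1)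
    (hl7 : legendreSym l (-7) = -1)
    [hE : (⟨0, ((-42 * l : ℤ) : ℚ), 0, ((448 * l ^ 2 : ℤ) : ℚ), 0⟩ : WeierstrassCurve ℚ).IsElliptic] :
    Nat.card (Set.range (⟨0, ((-2 * (-42 * l) : ℤ) : ℚ), 0, (((-42 * l) ^ 2 - 4 * (448 * l ^ 2) : ℤ) : ℚ), 0⟩ :
      WeierstrassCurve ℚ).xSqClass) ≤ 2 := by
  have hl : l.Prime := Fact.out
  have hab := hab_inertTwoTwist hl.pos
  have h := two_pow_twoIsogenySelmerRank'_eq_natCard_mul hab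
  have hS' : 2 ^ twoIsogenySelmerRank' (-42 * l) (448 * l ^ 2) ≤ 2 := by
    rw [two_pow_twoIsogenySelmerRank'_eq_card hab]
    exact le_trans (Finset.card_le_card fun d hd => mem_of_mem_twoIsogenySelmerGroup'_twoPrimeTwist hl4 hl7 hd)
      Finset.card_le_two
  have hm : 1 ≤ Nat.card ↥((⟨0, ((-42 * l : ℤ) : ℚ), 0, ((448 * l ^ 2 : ℤ) : ℚ), 0⟩ : WeierstrassCurve ℚ).sha ⊓
      (⟨0, ((-42 * l : ℤ) : ℚ), 0, ((448 * l ^ 2 : ℤ) : ℚ), 0⟩ : WeierstrassCurve ℚ).twoIsogenyTorsorHom.range) := by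
    refine Nat.one_le_iff_ne_zero.mpr fun h0 => ?_
    rw [h0, mul_zero] at h
    exact pow_ne_zero _ two_ne_zero h
  calc _ ≤ _ * Nat.card ↥((⟨0, ((-42 * l : ℤ) : ℚ), 0, ((448 * l ^ 2 : ℤ) : ℚ), 0⟩ : WeierstrassCurve ℚ).sha ⊓
          (⟨0, ((-42 * l : ℤ) : ℚ), 0, ((448 * l ^ 2 : ℤ) : ℚ), 0⟩ : WeierstrassCurve ℚ).twoIsogenyTorsorHom.range) :=
        Nat.le_mul_of_pos_right _ hm
    _ = 2 ^ twoIsogenySelmerRank' (-42 * l) (448 * l ^ 2) := h.symm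
    _ ≤ 2 := hS'

/-- **In rank one, some rational point of `E_{−2q}` has `α(P) = [2]`**: `#α(E(ℚ)) · #α′ = 2^{1+2} = 8` with `#α′ ≤ 2` forces
`#α(E(ℚ)) = 4`; as `α(E(ℚ)) ⊆ [S(−42q, 448q²)] ⊆ {[1],[2],[7],[14]}`, equality holds and `[2]` is attained.
[cite: SilvermanTate2015, §3.6 (2^r = #α(Γ)·#ᾱ(Γ̄)/4)] [cite: SilvermanAEC2009, Prop. X.4.9] -/
theorem exists_xSqClass_eq_two_twoPrimeTwist [Fact l.Prime] (hl4 : l % 4 = 1) (hl7 : legendreSym l (-7) = -1)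
    [hE : (⟨0, ((-42 * l : ℤ) : ℚ), 0, ((448 * l ^ 2 : ℤ) : ℚ), 0⟩ : WeierstrassCurve ℚ).IsElliptic]
    (hr : (⟨0, ((-42 * l : ℤ) : ℚ), 0, ((448 * l ^ 2 : ℤ) : ℚ), 0⟩ : WeierstrassCurve ℚ).mordellWeilRank = 1) :
    ∃ P : (⟨0, ((-42 * l : ℤ) : ℚ), 0, ((448 * l ^ 2 : ℤ) : ℚ), 0⟩ : WeierstrassCurve ℚ).toAffine.Point,
      (⟨0, ((-42 * l : ℤ) : ℚ), 0, ((448 * l ^ 2 : ℤ) : ℚ), 0⟩ : WeierstrassCurve ℚ).xSqClass P = sqClass (2 : ℚ) := by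
  have hl : l.Prime := Fact.out
  have hab := hab_inertTwoTwist hl.pos
  have hN' := natCard_range_xSqClass_codomain_le_two_twoPrimeTwist hl4 hl7 (hE := hE)
  -- `#α · #α′ = 8`
  have hcount := (⟨0, ((-42 * l : ℤ) : ℚ), 0, ((448 * l ^ 2 : ℤ) : ℚ), 0⟩ : WeierstrassCurve ℚ).natCard_range_xSqClass_mul
  have h8 : (2 : ℕ) ^ ((1 : ℕ) + 2) = 8 := by norm_num
  rw [twoIsogenyCodomain_mk_intCast, hr, h8] at hcount
  -- `#α ≥ 4`
  have hN : 4 ≤ Nat.card (Set.range (⟨0, ((-42 * l : ℤ) : ℚ), 0, ((448 * l ^ 2 : ℤ) : ℚ), 0⟩ :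
      WeierstrassCurve ℚ).xSqClass) := by
    by_contra hlt
    rw [not_le] at hlt
    have h6 : Nat.card (Set.range (⟨0, ((-42 * l : ℤ) : ℚ), 0, ((448 * l ^ 2 : ℤ) : ℚ), 0⟩ :
        WeierstrassCurve ℚ).xSqClass) *
        Nat.card (Set.range (⟨0, ((-2 * (-42 * l) : ℤ) : ℚ), 0, (((-42 * l) ^ 2 - 4 * (448 * l ^ 2) : ℤ) : ℚ), 0⟩ :
          WeierstrassCurve ℚ).xSqClass) ≤ 3 * 2 := Nat.mul_le_mul (by omega) hN'
    omega
  -- `α(E(ℚ)) ⊆ [S] ⊆ {[1],[2],[7],[14]}`, with `#S ≤ 4`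
  set S := twoIsogenySelmerGroup (-42 * (l : ℤ)) (448 * (l : ℤ) ^ 2) with hS
  have hsub := range_xSqClass_subset_image_twoIsogenySelmerGroup hab
  have hS4 : S ⊆ ({1, 2, 7, 14} : Finset ℤ) := fun d hd => mem_of_mem_twoIsogenySelmerGroup_twoPrimeTwist hl4 hl7 hd
  have hfinT : (↑(S.image fun d : ℤ => sqClass (d : ℚ)) : Set (Affine.SqUnits ℚ)).Finite := Finset.finite_toSet _
  have hTle : (S.image fun d : ℤ => sqClass (d : ℚ)).card ≤ 4 :=
    le_trans Finset.card_image_le (le_trans (Finset.card_le_card hS4) card_one_two_seven_fourteen.le)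
  have hrange : Set.range (⟨0, ((-42 * l : ℤ) : ℚ), 0, ((448 * l ^ 2 : ℤ) : ℚ), 0⟩ : WeierstrassCurve ℚ).xSqClass =
      ↑(S.image fun d : ℤ => sqClass (d : ℚ)) := by
    refine Set.eq_of_subset_of_ncard_le hsub ?_ hfinT
    rw [Set.ncard_coe_finset, ← Nat.card_coe_set_eq]
    exact le_trans hTle hN
  have hScard : 4 ≤ S.card := by
    calc 4 ≤ Nat.card (Set.range (⟨0, ((-42 * l : ℤ) : ℚ), 0, ((448 * l ^ 2 : ℤ) : ℚ), 0⟩ :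
          WeierstrassCurve ℚ).xSqClass) := hN
      _ = (Set.range (⟨0, ((-42 * l : ℤ) : ℚ), 0, ((448 * l ^ 2 : ℤ) : ℚ), 0⟩ :
          WeierstrassCurve ℚ).xSqClass).ncard := Nat.card_coe_set_eq _
      _ = (↑(S.image fun d : ℤ => sqClass (d : ℚ)) : Set (Affine.SqUnits ℚ)).ncard := by rw [hrange]
      _ = (S.image fun d : ℤ => sqClass (d : ℚ)).card := Set.ncard_coe_finset _
      _ ≤ S.card := Finset.card_image_le
  have hSeq : S = ({1, 2, 7, 14} : Finset ℤ) :=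
    Finset.eq_of_subset_of_card_le hS4 (by rw [card_one_two_seven_fourteen]; exact hScard)
  have h2S : (2 : ℤ) ∈ S := by rw [hSeq]; decide
  have h2 : sqClass ((2 : ℤ) : ℚ) ∈ Set.range (⟨0, ((-42 * l : ℤ) : ℚ), 0, ((448 * l ^ 2 : ℤ) : ℚ), 0⟩ :
      WeierstrassCurve ℚ).xSqClass := by
    rw [hrange, Finset.mem_coe]
    exact Finset.mem_image_of_mem _ h2S
  obtain ⟨P, hP⟩ := h2
  exact ⟨P, by rw [hP]; norm_cast⟩

end DescentNegEight

/-! ## §4 A point with `α(P) = [2]` is not divisible by `2` over `K = ℚ(√−2q)`; transport to every model -/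

section NotHalvableNegEight

variable {K : Type} [Field K] [NumberField K]

/-- **A rational point `P` of `E_{−2q}` with `α(P) = [2]` is not in `2E(K) + E(K)_tors`** for `K` imaginary quadratic with
`d_K = −8q`: `x(P) = 2r² ≠ 0` and `x(P)`, `x(P)·b ~ 14`, `b = 448q² ~ 7`, `a² − 4b = −28q² ~ −7` are not squares in `K`
(`not_isSquare_negEightField`) — Silverman–Tate's `α` over `K` (tree `some_ne_two_zsmul_add_of_not_isSquare`).
[cite: SilvermanTate2015, §3.5] -/
theorem incl_ne_two_zsmul_add_of_xSqClass_eq_two_negEight (hK : IsImaginaryQuadratic K) {q : ℕ} (hq : q.Prime)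
    (hq7 : jacobiSym q 7 = -1) (hdK : NumberField.discr K = -(8 * (q : ℤ)))
    [hE : (⟨0, ((-42 * q : ℤ) : ℚ), 0, ((448 * q ^ 2 : ℤ) : ℚ), 0⟩ : WeierstrassCurve ℚ).IsElliptic]
    {P : (⟨0, ((-42 * q : ℤ) : ℚ), 0, ((448 * q ^ 2 : ℤ) : ℚ), 0⟩ : WeierstrassCurve ℚ).toAffine.Point}
    (hP : (⟨0, ((-42 * q : ℤ) : ℚ), 0, ((448 * q ^ 2 : ℤ) : ℚ), 0⟩ : WeierstrassCurve ℚ).xSqClass P = sqClass (2 : ℚ))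
    (R t : ((⟨0, ((-42 * q : ℤ) : ℚ), 0, ((448 * q ^ 2 : ℤ) : ℚ), 0⟩ : WeierstrassCurve ℚ).baseChange K).toAffine.Point)
    (ht : IsOfFinAddOrder t) :
    incl K (⟨0, ((-42 * q : ℤ) : ℚ), 0, ((448 * q ^ 2 : ℤ) : ℚ), 0⟩ : WeierstrassCurve ℚ) P ≠ (2 : ℤ) • R + t := by
  obtain ⟨hq2, hq7'⟩ := ne_two_and_ne_seven_of_jacobiSym hq7
  obtain ⟨h7, h7', h2, h14⟩ := not_isSquare_negEightField hK hq hq7 hdK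
  obtain ⟨-, -, -, ⟨n2, -⟩, -, ⟨n14, -⟩⟩ := not_isSquare_genusConstants hq hq2 hq7'
  have hq0 : (q : ℚ) ≠ 0 := by exact_mod_cast hq.ne_zero
  have hqK : (q : K) ≠ 0 := by exact_mod_cast hq.ne_zero
  have hb : ((448 * q ^ 2 : ℤ) : ℚ) ≠ 0 := by push_cast; positivity
  rcases P with _ | ⟨x, y, h⟩
  · -- `α(O) = 1 ≠ [2]`
    exfalso
    have hP' : (⟨0, ((-42 * q : ℤ) : ℚ), 0, ((448 * q ^ 2 : ℤ) : ℚ), 0⟩ : WeierstrassCurve ℚ).xSqClass 0 =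
        sqClass (2 : ℚ) := hP
    rw [xSqClass_zero, eq_comm, sqClass_eq_one_iff two_ne_zero] at hP'
    obtain ⟨u, hu⟩ := hP'
    exact n2 ⟨u, by rw [hu]; ring⟩
  · by_cases hx : x = 0
    · -- `α(T) = [b] = [448q²] ≠ [2]` (`896q² = 14·(8q)²` is not a square)
      exfalso
      rw [xSqClass_some_of_eq_zero _ hx] at hP
      change sqClass (((448 * q ^ 2 : ℤ) : ℚ)) = sqClass (2 : ℚ) at hP
      have h1 : sqClass (((448 * q ^ 2 : ℤ) : ℚ) * 2) = 1 := by
        rw [sqClass_mul hb two_ne_zero, hP, Affine.SqUnits.mul_self]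
      obtain ⟨u, hu⟩ := (sqClass_eq_one_iff (mul_ne_zero hb two_ne_zero)).mp h1
      refine n14 (isSquare_of_sq_mul (k := 8 * (q : ℚ)) (by positivity) (r := u) ?_)
      push_cast at hu
      linear_combination hu.symm
    · rw [xSqClass_some_of_ne_zero _ hx] at hP
      -- `2x = u²`
      obtain ⟨u, hu⟩ := (sqClass_eq_one_iff (mul_ne_zero hx two_ne_zero)).mp
        (by rw [sqClass_mul hx two_ne_zero, hP, Affine.SqUnits.mul_self])
      have hu0 : u ≠ 0 := by rintro rfl; exact mul_ne_zero hx two_ne_zero (by rw [hu]; ring)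
      -- over `K`
      haveI : ((⟨0, ((-42 * q : ℤ) : ℚ), 0, ((448 * q ^ 2 : ℤ) : ℚ), 0⟩ : WeierstrassCurve ℚ).baseChange K).IsTwoTorsionNF :=
        ⟨by simp [WeierstrassCurve.baseChange], by simp [WeierstrassCurve.baseChange], by simp [WeierstrassCurve.baseChange]⟩
      have hD : ¬ IsSquare (((⟨0, ((-42 * q : ℤ) : ℚ), 0, ((448 * q ^ 2 : ℤ) : ℚ), 0⟩ : WeierstrassCurve ℚ).baseChange K).a₂ ^ 2 -
          4 * ((⟨0, ((-42 * q : ℤ) : ℚ), 0, ((448 * q ^ 2 : ℤ) : ℚ), 0⟩ : WeierstrassCurve ℚ).baseChange K).a₄) := by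
        have e : ((⟨0, ((-42 * q : ℤ) : ℚ), 0, ((448 * q ^ 2 : ℤ) : ℚ), 0⟩ : WeierstrassCurve ℚ).baseChange K).a₂ ^ 2 -
            4 * ((⟨0, ((-42 * q : ℤ) : ℚ), 0, ((448 * q ^ 2 : ℤ) : ℚ), 0⟩ : WeierstrassCurve ℚ).baseChange K).a₄ =
            -7 * ((2 * (q : K)) * (2 * (q : K))) := by
          simp [WeierstrassCurve.baseChange]; ring
        rw [e]; rintro ⟨r, hr⟩
        exact h7 (isSquare_of_sq_mul (k := 2 * (q : K)) (mul_ne_zero two_ne_zero hqK) (r := r)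
          (by linear_combination hr.symm))
      have hbK : ¬ IsSquare ((⟨0, ((-42 * q : ℤ) : ℚ), 0, ((448 * q ^ 2 : ℤ) : ℚ), 0⟩ : WeierstrassCurve ℚ).baseChange K).a₄ := by
        have e : ((⟨0, ((-42 * q : ℤ) : ℚ), 0, ((448 * q ^ 2 : ℤ) : ℚ), 0⟩ : WeierstrassCurve ℚ).baseChange K).a₄ =
            7 * ((8 * (q : K)) * (8 * (q : K))) := by
          simp [WeierstrassCurve.baseChange]; ring
        rw [e]; rintro ⟨r, hr⟩
        exact h7' (isSquare_of_sq_mul (k := 8 * (q : K)) (mul_ne_zero (by norm_num) hqK) (r := r)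
          (by linear_combination hr.symm))
      have hxK : (algebraMap ℚ K x) ≠ 0 := by rw [eq_ratCast]; exact_mod_cast hx
      have h₁ : ¬ IsSquare (algebraMap ℚ K x) := by
        rw [eq_ratCast]; rintro ⟨r, hr⟩
        have hr0 : r ≠ 0 := by rintro rfl; exact hxK (by rw [eq_ratCast, hr, mul_zero])
        refine h2 (isSquare_of_sq_mul (k := r) hr0 (r := (u : K)) ?_)
        have hu' : ((x : ℚ) : K) * 2 = (u : K) ^ 2 := by exact_mod_cast congrArg (fun z : ℚ => (z : K)) hu
        linear_combination -hu' + 2 * hr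
      have h₂ : ¬ IsSquare (algebraMap ℚ K x *
          ((⟨0, ((-42 * q : ℤ) : ℚ), 0, ((448 * q ^ 2 : ℤ) : ℚ), 0⟩ : WeierstrassCurve ℚ).baseChange K).a₄) := by
        have e : ((⟨0, ((-42 * q : ℤ) : ℚ), 0, ((448 * q ^ 2 : ℤ) : ℚ), 0⟩ : WeierstrassCurve ℚ).baseChange K).a₄ =
            448 * (q : K) ^ 2 := by simp [WeierstrassCurve.baseChange]
        rw [e, eq_ratCast]; rintro ⟨r, hr⟩
        have hu' : ((x : ℚ) : K) * 2 = (u : K) ^ 2 := by exact_mod_cast congrArg (fun z : ℚ => (z : K)) hu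
        refine h14 (isSquare_of_sq_mul (k := 4 * (u : K) * q) ?_ (r := r) ?_)
        · exact mul_ne_zero (mul_ne_zero (by norm_num) (by exact_mod_cast hu0)) hqK
        · linear_combination hr.symm + 224 * (q : K) ^ 2 * hu'
      intro hPt
      have hmap : incl K (⟨0, ((-42 * q : ℤ) : ℚ), 0, ((448 * q ^ 2 : ℤ) : ℚ), 0⟩ : WeierstrassCurve ℚ) (.some x y h) =
          .some (algebraMap ℚ K x) (algebraMap ℚ K y) ((Affine.baseChange_nonsingular
            (W := (⟨0, ((-42 * q : ℤ) : ℚ), 0, ((448 * q ^ 2 : ℤ) : ℚ), 0⟩ : WeierstrassCurve ℚ))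
            (f := Algebra.ofId ℚ K) (algebraMap ℚ K).injective x y).mpr h) := rfl
      rw [hmap] at hPt
      exact some_ne_two_zsmul_add_of_not_isSquare _ hD hbK _ hxK h₁ h₂ R t ht hPt

/-- `(⟨½, 2d, 0, 0⟩·C) • W = E_{−2q}` for `C • W = X₀(49)^{(−2q)}` (seat c301 gen 2's two-torsion model at `d = −2q`).
[cite: SilvermanAEC2009, III.1 and X.5 Cor. 5.4] -/
theorem smul_eq_twoTorsionModel_twoPrimeTwist {q : ℕ} (W : WeierstrassCurve ℚ) (C : VariableChange ℚ)
    (hC : C • W = cm7.quadraticTwist ((-2 * q : ℤ) : ℚ)) :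
    ((⟨(Units.mk0 (2 : ℚ) two_ne_zero)⁻¹, 2 * ((-2 * q : ℤ) : ℚ), 0, 0⟩ : VariableChange ℚ) * C) • W =
      ⟨0, ((-42 * q : ℤ) : ℚ), 0, ((448 * q ^ 2 : ℤ) : ℚ), 0⟩ :=
  (smul_eq_twoTorsionModel_of_smul_eq_quadraticTwist (-2 * q) W C hC).trans
    (show (⟨0, ((21 * (-2 * q : ℤ) : ℤ) : ℚ), 0, ((112 * (-2 * q : ℤ) ^ 2 : ℤ) : ℚ), 0⟩ :
        WeierstrassCurve ℚ) = ⟨0, ((-42 * q : ℤ) : ℚ), 0, ((448 * q ^ 2 : ℤ) : ℚ), 0⟩ by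
      ext <;> push_cast <;> ring)

/-- **THE HALVABILITY VALUE IS `k = 1` ON THE WHOLE FAMILY F2.** For `q ≡ 1 (mod 4)` prime with `(q/7) = −1`, `K` imaginary
quadratic with `d_K = −8q`, and ANY elliptic `W/ℚ` with `C • W = X₀(49)^{(−2q)}` and `rank W(ℚ) = 1`: NOT every `y ∈ W(ℚ)` is
divisible by `2` in `W(K)` up to torsion. (Transport of §§3–4 along the `ℚ`-isomorphism `(⟨½,2d,0,0⟩·C) • W = E_{−2q}` and its
base change to `K`, F1's `pointEquivBaseChange_incl` / `congrEquiv_incl`.) In `X049BirchLemmaEvenDiscrEight` this empties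
the `k = 2` branch on F2. [cite: SilvermanTate2015, §3.5–3.6] [cite: SilvermanAEC2009, Prop. X.4.9 and Exercise 10.16] -/
theorem not_forall_halvable_twoPrimeTwist (hK : IsImaginaryQuadratic K) {q : ℕ} (hq : q.Prime) (hq4 : q % 4 = 1)
    (hq7 : jacobiSym q 7 = -1) (hdK : NumberField.discr K = -(8 * (q : ℤ)))
    (W : WeierstrassCurve ℚ) [W.IsElliptic] (C₁ : VariableChange ℚ)
    (hC₁ : C₁ • W = cm7.quadraticTwist ((-2 * q : ℤ) : ℚ)) (hr : W.mordellWeilRank = 1) :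
    ¬ ∀ y : W.toAffine.Point, ∃ Q : (W.baseChange K).toAffine.Point,
        incl K W y - (2 : ℤ) • Q ∈ AddCommGroup.torsion (W.baseChange K).toAffine.Point := by
  haveI := Fact.mk hq
  have hl7 : legendreSym q (-7) = -1 := by rw [← jacobiSym_seven_eq_legendreSym_neg_seven hq4]; exact hq7
  -- `C • W = E_{−2q}`
  have hCE := smul_eq_twoTorsionModel_twoPrimeTwist W C₁ hC₁
  set C : VariableChange ℚ := ⟨(Units.mk0 (2 : ℚ) two_ne_zero)⁻¹, 2 * ((-2 * q : ℤ) : ℚ), 0, 0⟩ * C₁ with hC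
  haveI hE : (⟨0, ((-42 * q : ℤ) : ℚ), 0, ((448 * q ^ 2 : ℤ) : ℚ), 0⟩ : WeierstrassCurve ℚ).IsElliptic := by
    rw [← hCE]; infer_instance
  -- rank transport
  have hrE : (⟨0, ((-42 * q : ℤ) : ℚ), 0, ((448 * q ^ 2 : ℤ) : ℚ), 0⟩ : WeierstrassCurve ℚ).mordellWeilRank = 1 := by
    rw [← mordellWeilRank_congr hCE, ← hr]
    have h := mordellWeilRank_variableChange_holds W C
    unfold mordellWeilRank_variableChange at h
    convert h using 2
  obtain ⟨P, hP⟩ := exists_xSqClass_eq_two_twoPrimeTwist hq4 hl7 (hE := hE) hrE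
  intro hall
  -- the rational point `y = C⁻¹ • P` of `W` and its hypothetical half `Q ∈ W(K)`
  set e₀ := (VariableChange.pointEquiv W C).trans (Affine.Point.congrEquiv hCE) with he₀
  obtain ⟨Q, hQ⟩ := hall (e₀.symm P)
  -- push forward to `E_{−2q}(K)`
  set Φ := (VariableChange.pointEquivBaseChange W C K).trans
    (Affine.Point.congrEquiv (congrArg (fun V : WeierstrassCurve ℚ => V.baseChange K) hCE)) with hΦ
  have hΦy : Φ (incl K W (e₀.symm P)) = incl K _ P := by
    rw [hΦ, AddEquiv.trans_apply, pointEquivBaseChange_incl, congrEquiv_incl hCE]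
    congr 1
    rw [he₀]
    simp only [AddEquiv.symm_trans_apply]
    rw [AddEquiv.apply_symm_apply, AddEquiv.apply_symm_apply]
  have ht : IsOfFinAddOrder (incl K _ P - (2 : ℤ) • Φ Q) := by
    rw [← hΦy, ← map_zsmul, ← map_sub]
    exact Φ.toAddMonoidHom.isOfFinAddOrder ((AddCommGroup.mem_torsion _).mp hQ)
  exact incl_ne_two_zsmul_add_of_xSqClass_eq_two_negEight hK hq hq7 hdK hP (Φ Q) _ ht (by abel)

end NotHalvableNegEight

end Summit.BirchSwinnertonDyer.BirchSwinnertonDyer.Theorems.GoldfeldGoodTwists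

end
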